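import Literature.InformationTheory.QuantumCodes.QuantumSingletonBoundGeneral
import HarnessLib

/-!
# Rains's weight-enumerator criterion for the minimum distance of a quantum code — proofs

Topic `Literature/InformationTheory/QuantumCodes` (venture QEC, cell `qec`, PARTITION v2 row 06 / D2.6). E. M. Rains,
*Quantum weight enumerators*, IEEE Trans. Inform. Theory 44 (1998) 1388–1394 = arXiv:quant-ph/9612015
[Rains1998Enumerators], §2: «Theorem 8. Let `𝒞` be a quantum code of dimension `K`, with associated projection `P`.
Then for `0 ≤ i ≤ n`, `K B'_i(P,P) ≥ A'_i(P,P)`. If `K B'_{d−1}(P,P) = A'_{d−1}(P,P)`, then `𝒞` has minimum distance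
at least `d`.» and «Corollary 9. … `𝒞` has minimum distance at least `d` if and only if `K B_i(P,P) = A_i(P,P)` for
`0 ≤ i < d`.», with the erasure form «Theorem 10. `K B'_S(P,P) = A'_S(P,P)` if and only if `Tr_{Sᶜ}(vv†)` is constant
when `v` ranges over unit vectors in `𝒞`» («if and only if the code `𝒞` can correct for the erasure of the qubits in
`S`»). THEOREMS ONLY, over `QuantumMacWilliams.lean` / `QuantumSingletonBoundGeneral.lean` (this seat):

* §1 the **equality case of the variance identity**: for a Hermitian idempotent `P` of trace `K` and a Pauli word
  `E`, `|Tr(EP)|² = K·Tr(EPEP)` forces `P E P = (Tr(EP)/K)·P` («this expectation is simply a variance; consequently,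
  it is 0 precisely when `⟨v|U|v⟩ = ⟨w|U|w⟩`», proof of Thm. 8) — `compress_eq_smul_of_normSq_eq`;
* §2 **Corollary 9** as an `iff` on the tree's `IsCodeProjection`: `IsCodeProjection P K d ↔ (P† = P ∧ P² = P ∧
  Tr P = K ∧ ∀ i < d, A_i(P) = K·B_i(P))` (`isCodeProjection_iff_enumA_eq`), and the **erasure / support form**
  (Thm. 8 equality clause with Thm. 10): `P` detects every Pauli word supported on `S` iff
  `2ⁿ·pauliWeight P S = K·4^{|S|}·pauliWeight P Sᶜ` (`detectsOn_iff_pauliWeight`) — the Fourier-weight («cleaning»)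
  test for correcting the erasure of `S`.

All theorems: column proved; no named facts, no new definitions except the predicate `DetectsOn` (definition).

## Mathlib / tree search

Tree: `enumA`, `enumB`, `slB`, `wordsOfWt`, `norm_pauliCoeff_sq_le`, `pauliCoeff_sq_eq_of_detects`,
`pauliCoeff_mul_self_of_isHermitian`, `star_pauliCoeff_of_isHermitian`, `enumA_feasible` (QuantumMacWilliams);
`slBOn`, `slBOn_eq_slAOn_compl`, `slAOn_self_of_isHermitian`, `pauliWt_le_card_of_mem_stringsOn`
(QuantumSingletonBoundGeneral); `stringsOn`, `pauliWeight` (QuantumComplexity). Mathlib: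
`Matrix.trace_conjTranspose_mul_self_eq_zero_iff`, `Finset.sum_eq_zero_iff_of_nonneg`.
-/

noncomputable section

open Finset Matrix
open Literature.Computability.QuantumComplexity

namespace Literature.InformationTheory.QuantumCodes

variable {ι : Type*} [Fintype ι] [DecidableEq ι]

open scoped ComplexOrder

/-! ### §1. The equality case of `K B_E − A_E ≥ 0` -/

/-- `Tr(E P E P)` is real for Hermitian `P` (trace of a product of two Hermitian operators).
[cite: Rains1998Enumerators, §1 Thm. 2 (K B_i(P,P) ≥ A_i(P,P) ≥ 0 — real quantities)] -/
theorem star_trace_conj_mul_of_isHermitian {P : Matrix (ι → Bool) (ι → Bool) ℂ} (hP : P.IsHermitian)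
    (E : ι → Pauli) : star (pauliString E * P * pauliString E * P).trace = (pauliString E * P * pauliString E * P).trace := by
  rw [← Matrix.trace_conjTranspose, Matrix.conjTranspose_mul, Matrix.conjTranspose_mul, Matrix.conjTranspose_mul,
    conjTranspose_pauliString, hP.eq, ← Matrix.mul_assoc, ← Matrix.mul_assoc, Matrix.trace_mul_cycle,
    ← Matrix.mul_assoc]

/-- **Equality in the variance bound forces Knill–Laflamme.** For a Hermitian idempotent `P` of trace `K` and a
Pauli word `E`: if `|Tr(EP)|² = K·Re Tr(EPEP)` then `P E P = (Tr(EP)/K)·P` (for `K = 0`, `P = 0`). This is the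
equality clause «with equality only when … `⟨v|U|v⟩ = ⟨w|U|w⟩` for `v`, `w` ranging over all unit vectors in `𝒞`»,
obtained here from `Tr(M†M) = K(K·Tr(EPEP) − Tr(EP)²) = 0` for `M = K·PEP − Tr(PEP)·P`.
[cite: Rains1998Enumerators, §2 Thm. 8 (proof: «this expectation is simply a variance»)] -/
theorem compress_eq_smul_of_normSq_eq {P : Matrix (ι → Bool) (ι → Bool) ℂ} (hP : P.IsHermitian) (hPP : P * P = P)
    {K : ℕ} (hK : P.trace = (K : ℂ)) {E : ι → Pauli}
    (heq : ‖pauliCoeff P E‖ ^ 2 = K * (pauliString E * P * pauliString E * P).trace.re) :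
    P * pauliString E * P = (pauliCoeff P E / K) • P := by
  rcases Nat.eq_zero_or_pos K with hK0 | hKpos
  · subst hK0
    have hP0 : P = 0 := by
      have h : (Pᴴ * P).trace = 0 := by rw [hP.eq, hPP, hK, Nat.cast_zero]
      exact Matrix.trace_conjTranspose_mul_self_eq_zero_iff.1 h
    simp [hP0]
  -- the algebra of `N = PEP` and `M = K N − Tr(N) P` (as in `norm_pauliCoeff_sq_le`)
  have hNP : P * pauliString E * P * P = P * pauliString E * P := by rw [Matrix.mul_assoc, hPP]
  have hPN : P * (P * pauliString E * P) = P * pauliString E * P := by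
    rw [← Matrix.mul_assoc, ← Matrix.mul_assoc, hPP]
  have htrN : (P * pauliString E * P).trace = pauliCoeff P E := by
    rw [pauliCoeff_eq, Matrix.trace_mul_comm, ← Matrix.mul_assoc, hPP, Matrix.trace_mul_comm]
  have htrNN : (P * pauliString E * P * (P * pauliString E * P)).trace =
      (pauliString E * P * pauliString E * P).trace := by
    rw [← Matrix.mul_assoc (P * pauliString E * P) (P * pauliString E) P,
      ← Matrix.mul_assoc (P * pauliString E * P) P (pauliString E), Matrix.mul_assoc (P * pauliString E) P P, hPP,
      Matrix.mul_assoc P (pauliString E) P, Matrix.mul_assoc P (pauliString E * P) (pauliString E),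
      Matrix.mul_assoc P (pauliString E * P * pauliString E) P, Matrix.trace_mul_comm,
      Matrix.mul_assoc (pauliString E * P * pauliString E) P P, hPP]
  have hNh : (P * pauliString E * P).IsHermitian := by
    change (P * pauliString E * P)ᴴ = P * pauliString E * P
    rw [Matrix.conjTranspose_mul, Matrix.conjTranspose_mul, conjTranspose_pauliString, hP.eq, Matrix.mul_assoc]
  set N : Matrix (ι → Bool) (ι → Bool) ℂ := P * pauliString E * P with hN
  set M : Matrix (ι → Bool) (ι → Bool) ℂ := (K : ℂ) • N - N.trace • P with hM
  have hMh : Mᴴ = M := by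
    rw [hM, Matrix.conjTranspose_sub, Matrix.conjTranspose_smul, Matrix.conjTranspose_smul, hNh.eq, hP.eq,
      htrN, star_pauliCoeff_of_isHermitian hP, Complex.star_def, Complex.conj_natCast]
  have hexp : (Mᴴ * M).trace = (K : ℂ) * ((K : ℂ) * (N * N).trace - N.trace * N.trace) := by
    rw [hMh, hM]
    simp only [Matrix.sub_mul, Matrix.mul_sub, Matrix.smul_mul, Matrix.mul_smul, hNP, hPN, hPP, Matrix.trace_sub,
      Matrix.trace_smul, smul_eq_mul, hK]
    ring
  -- the bracket vanishes: `K Tr(EPEP) = Tr(EP)²` as complex numbers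
  have hB : (pauliString E * P * pauliString E * P).trace =
      (((pauliString E * P * pauliString E * P).trace.re : ℝ) : ℂ) := by
    have h := star_trace_conj_mul_of_isHermitian hP E
    rw [Complex.star_def] at h
    exact (Complex.conj_eq_iff_re.1 h).symm
  have hzero : (K : ℂ) * (N * N).trace - N.trace * N.trace = 0 := by
    rw [htrNN, htrN, pauliCoeff_mul_self_of_isHermitian hP, hB, heq]
    push_cast
    ring
  have hM0 : M = 0 := by
    apply Matrix.trace_conjTranspose_mul_self_eq_zero_iff.1
    rw [hexp, hzero, mul_zero]
  -- read off `K • N = Tr(N) • P`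
  have hKN : (K : ℂ) • N = N.trace • P := sub_eq_zero.1 (by rw [← hM, hM0])
  have hKc : (K : ℂ) ≠ 0 := Nat.cast_ne_zero.2 hKpos.ne'
  calc N = (K : ℂ)⁻¹ • ((K : ℂ) • N) := by rw [smul_smul, inv_mul_cancel₀ hKc, one_smul]
    _ = (pauliCoeff P E / K) • P := by rw [hKN, smul_smul, htrN, div_eq_inv_mul]

/-! ### §2. Corollary 9 and the erasure form -/

/-- **Rains's Corollary 9 (with Theorem 2): the minimum-distance criterion in terms of the Shor–Laflamme
enumerators.** `P` is the projection onto an `((n,K,d))` (tree reading: Hermitian idempotent of trace `K` detecting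
every Pauli error of weight `≤ d−1`) iff `P` is a Hermitian idempotent of trace `K` with `A_i(P) = K·B_i(P)` for all
`i < d` («`𝒞` has minimum distance at least `d` if and only if `K B_i(P,P) = A_i(P,P)` for `0 ≤ i < d`»).
[cite: Rains1998Enumerators, §2 Cor. 9 (with Thm. 8 for the equality clause)] -/
theorem isCodeProjection_iff_enumA_eq {K d : ℕ} {P : Matrix (ι → Bool) (ι → Bool) ℂ} :
    IsCodeProjection P K d ↔
      P.IsHermitian ∧ P * P = P ∧ P.trace = (K : ℂ) ∧ ∀ i, i < d → enumA P i = K * enumB P i := by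
  constructor
  · intro hP
    refine ⟨hP.1, hP.2.1, hP.2.2.1, fun i hi => ?_⟩
    rw [(enumA_feasible hP).2.2.1 i hi, enumB_eq_rainsDual hP.1]
  · rintro ⟨hH, hPP, htr, hAB⟩
    refine ⟨hH, hPP, htr, fun E hE => ?_⟩
    rcases Nat.eq_zero_or_pos d with hd | hd
    · -- `d = 0`: only the identity word is to be detected
      subst hd
      have hE0 : E = fun _ => Pauli.I := by
        funext i
        by_contra h
        have : 0 < pauliWt E := Finset.card_pos.2 ⟨i, by simpa using h⟩
        omega
      exact ⟨1, by rw [hE0, pauliString_const_I, Matrix.mul_one, hPP, one_smul]⟩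
    -- the weight class of `E`: a sum of nonnegative terms `K B_F − A_F` that vanishes
    have hi : pauliWt E < d := by omega
    have hsum := hAB (pauliWt E) hi
    rw [enumA, enumB, slB, Complex.re_sum, Finset.mul_sum] at hsum
    have hterm : ∀ F ∈ wordsOfWt ι (pauliWt E),
        0 ≤ K * (pauliString F * P * pauliString F * P).trace.re - ‖pauliCoeff P F‖ ^ 2 :=
      fun F _ => sub_nonneg.2 (norm_pauliCoeff_sq_le hH hPP htr F)
    have hzero : ∑ F ∈ wordsOfWt ι (pauliWt E),
        (K * (pauliString F * P * pauliString F * P).trace.re - ‖pauliCoeff P F‖ ^ 2) = 0 := by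
      rw [Finset.sum_sub_distrib, ← hsum, sub_self]
    have hEq := (Finset.sum_eq_zero_iff_of_nonneg hterm).1 hzero E (mem_wordsOfWt.2 rfl)
    exact ⟨_, compress_eq_smul_of_normSq_eq hH hPP htr (sub_eq_zero.1 hEq).symm⟩

/-- **Detection of every Pauli word supported on a qubit set `S`** (the erasure of `S` is correctable):
`P E P = c_E P` for all words `E` with `supp E ⊆ S`. Column: definition (predicate).
[cite: Rains1998Enumerators, §2 Thm. 10 and the remark after it («the code `𝒞` can correct for the erasure of the
qubits in `S`»)] -/
def DetectsOn (P : Matrix (ι → Bool) (ι → Bool) ℂ) (S : Finset ι) : Prop :=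
  ∀ E ∈ stringsOn S, ∃ c : ℂ, P * pauliString E * P = c • P

/-- **Rains's Theorem 8 (equality clause) with Theorem 10, support form: the Fourier-weight test for erasure
correction.** For a Hermitian idempotent `P` of trace `K` on `n` qubits and a qubit set `S`: `P` detects every Pauli
word supported on `S` iff `2ⁿ · Σ_{supp E ⊆ S} |Tr(EP)|² = K · 4^{|S|} · Σ_{supp E ⊆ Sᶜ} |Tr(EP)|²`, i.e.
`K B'_S(P,P) = A'_S(P,P)` written through the duality `B'_S = A'_{Sᶜ}` and the tree's `pauliWeight`.
[cite: Rains1998Enumerators, §2 Thm. 8 («If `K B'_{d−1} = A'_{d−1}` then … minimum distance at least `d`») and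
Thm. 10 («`K B'_S(P,P) = A'_S(P,P)` if and only if … correct for the erasure of the qubits in `S`»)] -/
theorem detectsOn_iff_pauliWeight {P : Matrix (ι → Bool) (ι → Bool) ℂ} (hH : P.IsHermitian) (hPP : P * P = P)
    {K : ℕ} (htr : P.trace = (K : ℂ)) (S : Finset ι) :
    DetectsOn P S ↔
      2 ^ Fintype.card ι * pauliWeight P S = K * 4 ^ #S * pauliWeight P Sᶜ := by
  -- the support sum `K b_S` in real form
  have hdual : K * (slBOn P P S).re = K * ((2 ^ Fintype.card ι)⁻¹ * 4 ^ #S * pauliWeight P Sᶜ) := by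
    rw [slBOn_eq_slAOn_compl, slAOn_self_of_isHermitian hH]
    congr 1
    have h : ((2 : ℂ) ^ Fintype.card ι)⁻¹ * 4 ^ #S * (pauliWeight P Sᶜ : ℂ) =
        (((2 ^ Fintype.card ι)⁻¹ * 4 ^ #S * pauliWeight P Sᶜ : ℝ) : ℂ) := by push_cast; ring
    rw [h, Complex.ofReal_re]
  have h2n : (0 : ℝ) < 2 ^ Fintype.card ι := by positivity
  -- reduce the real identity to `pauliWeight P S = K·Re b_S`
  have key : (2 ^ Fintype.card ι * pauliWeight P S = K * 4 ^ #S * pauliWeight P Sᶜ) ↔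
      pauliWeight P S = K * (slBOn P P S).re := by
    rw [hdual]
    constructor
    · intro h
      field_simp
      linarith
    · intro h
      rw [h]
      field_simp
  rw [key]
  constructor
  · -- (→): termwise Knill–Laflamme
    intro hdet
    rw [pauliWeight_eq, slBOn, Complex.re_sum, Finset.mul_sum]
    refine Finset.sum_congr rfl fun E hE => ?_
    obtain ⟨c, hc⟩ := hdet E hE
    have h := pauliCoeff_sq_eq_of_detects hPP htr hc
    rw [pauliCoeff_mul_self_of_isHermitian hH] at h
    have h' := congrArg Complex.re h
    rw [Complex.ofReal_re, Complex.mul_re, Complex.natCast_re, Complex.natCast_im, zero_mul, sub_zero] at h'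
    exact h'
  · -- (←): a vanishing sum of nonnegative terms
    intro hsum E hE
    rw [pauliWeight_eq, slBOn, Complex.re_sum, Finset.mul_sum] at hsum
    have hterm : ∀ F ∈ stringsOn S,
        0 ≤ K * (pauliString F * P * pauliString F * P).trace.re - ‖pauliCoeff P F‖ ^ 2 :=
      fun F _ => sub_nonneg.2 (norm_pauliCoeff_sq_le hH hPP htr F)
    have hzero : ∑ F ∈ stringsOn S,
        (K * (pauliString F * P * pauliString F * P).trace.re - ‖pauliCoeff P F‖ ^ 2) = 0 := by
      rw [Finset.sum_sub_distrib, ← hsum, sub_self]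
    have hEq := (Finset.sum_eq_zero_iff_of_nonneg hterm).1 hzero E hE
    exact ⟨_, compress_eq_smul_of_normSq_eq hH hPP htr (sub_eq_zero.1 hEq).symm⟩

/-- **Theorem 11, enumerator form: distance `≥ d` iff every erasure of `d − 1` qubits is correctable.** For a
Hermitian idempotent `P` of trace `K`: `P` detects every Pauli error of weight `≤ d − 1` iff it detects every word
supported on every qubit set of size `≤ d − 1`, iff the Fourier-weight test holds for every such set.
[cite: Rains1998Enumerators, §2 Thm. 11 («A quantum code `𝒞` has minimum distance `d` if and only if it can correct
for any erasure of size `d−1`»)] -/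
theorem detectsWeightLE_iff_forall_pauliWeight {P : Matrix (ι → Bool) (ι → Bool) ℂ} (hH : P.IsHermitian)
    (hPP : P * P = P) {K : ℕ} (htr : P.trace = (K : ℂ)) (t : ℕ) :
    DetectsWeightLE P t ↔
      ∀ S : Finset ι, #S ≤ t → 2 ^ Fintype.card ι * pauliWeight P S = K * 4 ^ #S * pauliWeight P Sᶜ := by
  constructor
  · intro hdet S hS
    exact (detectsOn_iff_pauliWeight hH hPP htr S).1 fun E hE =>
      hdet E ((pauliWt_le_card_of_mem_stringsOn hE).trans hS)
  · intro h E hE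
    -- `E` is supported on its own support, a set of size `wt E ≤ t`
    have hsupp : E ∈ stringsOn (univ.filter fun i => E i ≠ Pauli.I) :=
      mem_stringsOn.2 fun i hi => by simpa using hi
    exact (detectsOn_iff_pauliWeight hH hPP htr _).2 (h _ (by simpa [pauliWt] using hE)) E hsupp

end Literature.InformationTheory.QuantumCodes
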